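/-
Origin: expansion seat `planner-pub-hodgecm-mc-theta-3-g3-0`, handover #1 2026-08-19T00:23Z md5 2497dc06b48e6c3a7b64e96f661274de (NEW additive leaf, 320 l.; ns HodgeCM.Model.SupplyResidual (+ .WeilPairData); imports HodgeCM.Model.SupplyDischarge only; level-indexed class supply data: WeilPairData.ClassSupplyDataAt, ClassSupplyData.toAt, WeilPairData.residualT_of_classSupplyDataAt / residual_of_ / supply_of_, ClassSupplyData.residualT_eq_of_toAt (rfl), ClassSupplyPack (`HOME/mc/pub-hodgecm-mc-theta-3-g3/lean/stage/HodgeCM/Model/SupplyClassLevel.lean`, md5 2497dc06, 320 lines);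
landed by the gen-9 packager (p-g9) in gate run 33 as `HodgeCM/Model/SupplyClassLevel.lean` (verbatim).
-/
/-
Copyright (c) 2026. Released under Apache 2.0 license as described in the file LICENSE.
Cell pub-hodgecm, MODEL layer (construction prover mc-theta-3, gen 3), node J-W7a (class level, LEVEL-INDEXED)
of `MODEL-DAG.md`.
-/
import Summits.HodgeConjecture.HodgeCM.Model.SupplyDischarge

/-!
# The junction J-W7a at the class level, indexed by the level `N` of the test function

`HodgeCM.Model.SupplyDischarge` discharges the residual `WeilPairData.ResidualT` of the supply lane from ONE
class-level record `ClassSupplyData P T V c k` whose `K`-type bookkeeping (`Kc`, `κ`, `σ`, `τ`), level `Γ₀`,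
class-map datum `D` and generating families `𝓙` are FIXED, while its field `fam` asks that EVERY test function
`φ_N = φ_∞ ⊗ 1_{x₀ + N 𝒪̂^J}` (`N ≥ 1`) be a value of a `κ`-equivariant family.  In the intended model that
record has no instance: the tree's `WeightForms.IsLevelCorrected P.ΓU κ τ ιinf Δ` forces `τ = 1` on the
level-correcting elements of `Kc`, so every theta form of the record is right-invariant under a FIXED open
compact subgroup of `G_U(𝔸_f)`, whereas the stabiliser of `φ_{N,f} = 1_{x₀ + N 𝒪̂^J}` shrinks with `N`
(finding F1 of the gen-3 seat, `STATUS.md` 2026-08-19T00:16:02Z).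

The residual, however, is a statement `∀ N ≥ 1, …`, and its proof in `ClassSupplyData.residualT` uses the
record only AT the given `N`.  This module therefore re-cuts the junction with the class-level data INDEXED BY
`N` — exactly the shape the construction has (level `Γ₀(N) ⊂ Stab(φ_{N,f})`, `Kc(N) = K_∞ × K_f(N)`,
`Δ(N)`, `D(N)`, `𝓙(N)`):

* `ClassSupplyDataAt P T V c k N` — the fields of `ClassSupplyData` verbatim, except that `fam` concerns the
  single test function `φ_N`;
* KERNEL `WeilPairData.residualT_of_classSupplyDataAt :
  (∀ N, 0 < N → P.ClassSupplyDataAt T V c k N) → P.ResidualT T V c k` (the proof of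
  `ClassSupplyData.residualT`, run at the record of index `N`);
* `ClassSupplyData.toAt` — the fixed-level record gives the level-indexed data (constant family), so the
  gen-2 interface is a special case of this one;
* `ClassSupplyPackN T V c k` (carriers + pair data + level-indexed class data), `ClassSupplyPack.toN`,
  `ClassSupplyPackN.toPairSupplyData`, and
  **`open_supply_of_classSupplyPackN : (∀ V c, T.GoodCtx ι₁ c → Nonempty (ClassSupplyPackN T V c 0) ∧
  Nonempty (ClassSupplyPackN T V c 1)) → T.Open_supply`** — `Open_supply` BY NAME; this is the hypothesis
  shape the assembler's binder `classPacks` should carry (it is implied by the gen-2 shape via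
  `ClassSupplyPack.toN`, `classSupplyPackN_of_classSupplyPack`).

Nothing is cited and nothing is minted: every statement is proved from the fields of the data records.
-/

set_option autoImplicit false

noncomputable section

open MeasureTheory NumberField NumberField.mixedEmbedding IsDedekindDomain
open Literature.NumberTheory.Automorphic Literature.NumberTheory.Weil1964
open HodgeCM.PerL34.Seesaw HodgeCM.PerL34.RationalCoset HodgeCM.PerL34.SupplyAdelic
open HodgeCM.Model.SupplyInstance HodgeCM.Model.SupplyResidual
open scoped Classical

namespace HodgeCM
namespace Model
namespace SupplyResidual

namespace WeilPairData

variable {K L : Type} [Field K] [NumberField K] [Field L] [NumberField L] [Algebra K L] [FiniteDimensional K L]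
variable {J : Type} [Fintype J] {GU : Type} [Group GU] [TopologicalSpace GU]
variable (P : WeilPairData K L J GU)
variable [IsTopologicalGroup GU] [LocallyCompactSpace GU]

/-! ### § 1. The class-level supply data at the test function `φ_N` -/

/-- **Class-level supply data AT `φ_N`** for the type index `k` in the context `(V, c)` over the pair data
`P`: the fields of `ClassSupplyData` (the `K`-type bookkeeping `Kc, κ, E, σ, W, τ, ι, hι`; the archimedean
component `G₁, K₁, ιinf, Δ, κ₁, τ₁, η₁` with the tree's `IsLevelCorrected` / `IsWeightMatched`; a level `Γ₀`
with a class-map datum `D` into the model universe; the generating sets `𝓙`, `𝓕`; the properties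
`char_mem` / `hol` / `theta_sub`) — all of which may now depend on `N` — and `fam` for THIS `N` only:
`φ_N = j (ι ℓ)` for some family `j ∈ 𝓙`.  Every property is an explicit field; nothing is asserted. -/
structure ClassSupplyDataAt [CompactSpace (GU ⧸ P.ΓU)] {U : Universe} (T : U.ThetaModel) {Lc : CMField}
    {ι₁ : Lc →+* ℂ} (V : HermSpace3 Lc ι₁) (c : SeesawCtx Lc) (k : Fin 4) (N : ℕ) : Type 1 where
  /-- index group of the `K`-types at level `N` (`K_f(N) × K_∞`) -/
  Kc : Type
  [instKc : Group Kc]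
  /-- its map to `G_U(𝔸)` -/
  κ : Kc →* GU
  /-- the `K`-type containing `φ_∞` -/
  E : Type
  [instE : AddCommGroup E]
  [instEm : Module ℂ E]
  /-- the action of `Kc` on it -/
  σ : Representation ℂ Kc E
  /-- the weight module -/
  W : Type
  [instW : AddCommGroup W]
  [instWm : Module ℂ W]
  [instWr : Module.IsReflexive ℂ W]
  /-- the weight -/
  τ : Representation ℂ Kc W
  /-- the `Kc`-map `W^∨ → E` -/
  ι : Module.Dual ℂ W →ₗ[ℂ] E
  /-- … intertwining `τ^∨` and `σ` -/
  hι : ∀ (x : Kc) (ℓ : Module.Dual ℂ W), ι (τ.dual x ℓ) = σ x (ι ℓ)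
  /-- the archimedean component group `G₁ = G_U(ℝ)` -/
  G₁ : Type
  [instG₁ : Group G₁]
  /-- its maximal compact `K₁` -/
  K₁ : Type
  [instK₁ : Group K₁]
  /-- the inclusion of the archimedean component -/
  ιinf : G₁ →* GU
  /-- the arithmetic subgroup at level `N` -/
  Δ : Subgroup G₁
  /-- `K₁ → G₁` -/
  κ₁ : K₁ →* G₁
  /-- the classical weight -/
  τ₁ : Representation ℂ K₁ W
  /-- `K₁ → Kc` over `ιinf` -/
  η₁ : K₁ →* Kc
  /-- level correction (tree `WeightForms.IsLevelCorrected`) -/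
  hΔ : WeightForms.IsLevelCorrected P.ΓU κ τ ιinf Δ
  /-- weight matching (tree `WeightForms.IsWeightMatched`) -/
  hη : WeightForms.IsWeightMatched κ τ ιinf κ₁ τ₁ η₁
  /-- the level at which the classes are produced (`Γ₀(N) ⊂ Stab(φ_{N,f})`) -/
  Γ₀ : Level V
  /-- the class-map datum of `Γ₀ \ 𝔹²` into the model universe (node D3-geom) -/
  D : WeightForms.ClassMapDatum ιinf hΔ hη (U.CohC (U.pms Lc ι₁ V Γ₀) 1)
  /-- the theta-equivariant test families generating the theta forms -/
  𝓙 : Set {j : E →ₗ[ℂ] P.weilDatum.ThetaTop // P.kernelDatum.IsThetaEquivariant κ σ j}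
  /-- the weight functions generating the theta forms -/
  𝓕 : Set C(relNormOneIdeles K L ⧸ relNormOneRat K L, ℂ)
  /-- (W-K∞)/(W-Kf) at level `N`: `φ_N` is the value at `ι ℓ` of a family in `𝓙` -/
  fam : ∃ j ∈ 𝓙, ∃ ℓ : Module.Dual ℂ W, j.1 (ι ℓ) = P.testFunT N
  /-- the inverted characters of the forced archimedean type are weight functions -/
  char_mem : ∀ χ : PontryaginDual (relNormOneIdeles K L ⧸ relNormOneRat K L),
    (∀ t : relNormOneInfUnits K L,
      ((χ ((relNormOneInfToIdeles K L t : relNormOneIdeles K L) :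
        relNormOneIdeles K L ⧸ relNormOneRat K L) : Circle) : ℂ) * P.w t = 1) → charInv χ ∈ 𝓕
  /-- W6b-hol: the restricted theta forms are holomorphic -/
  hol : ∀ j ∈ 𝓙, ∀ f ∈ 𝓕, WeightForms.restrictHom ιinf hΔ hη
    (P.kernelDatum.thetaForm (probHaarRelNormOneQuot K L) P.kernelDatum_thetaLinear κ j.1 j.2 ι hι f) ∈ D.Hol
  /-- the model's `Θ_k` at level `Γ₀` contains the theta classes (the assembler's definition of `Θ_k`) -/
  theta_sub : WeightForms.thetaClasses ιinf D
    (P.kernelDatum.thetaForms (probHaarRelNormOneQuot K L) P.kernelDatum_thetaLinear κ σ ι hι 𝓙 𝓕) ⊆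
      T.Theta V c k Γ₀

attribute [instance] ClassSupplyDataAt.instKc ClassSupplyDataAt.instE ClassSupplyDataAt.instEm
  ClassSupplyDataAt.instW ClassSupplyDataAt.instWm ClassSupplyDataAt.instWr ClassSupplyDataAt.instG₁
  ClassSupplyDataAt.instK₁

variable [CompactSpace (GU ⧸ P.ΓU)] {U : Universe} {T : U.ThetaModel} {Lc : CMField} {ι₁ : Lc →+* ℂ}
  {V : HermSpace3 Lc ι₁} {c : SeesawCtx Lc} {k : Fin 4}

/-- The fixed-level record of `SupplyDischarge` gives level-indexed data (the constant family). -/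
def ClassSupplyData.toAt (S : P.ClassSupplyData T V c k) (N : ℕ) (hN : 0 < N) :
    P.ClassSupplyDataAt T V c k N where
  Kc := S.Kc
  κ := S.κ
  E := S.E
  σ := S.σ
  W := S.W
  τ := S.τ
  ι := S.ι
  hι := S.hι
  G₁ := S.G₁
  K₁ := S.K₁
  ιinf := S.ιinf
  Δ := S.Δ
  κ₁ := S.κ₁
  τ₁ := S.τ₁
  η₁ := S.η₁
  hΔ := S.hΔ
  hη := S.hη
  Γ₀ := S.Γ₀
  D := S.D
  𝓙 := S.𝓙
  𝓕 := S.𝓕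
  fam := S.fam N hN
  char_mem := S.char_mem
  hol := S.hol
  theta_sub := S.theta_sub

/-! ### § 2. (W-resT) from level-indexed class data (kernel) -/

/-- **(W-resT) discharged from level-indexed class data**: the proof of `ClassSupplyData.residualT`, run in the
record of index `N` — `exists_thetaClass_mem_H10_ne_zero` at the archimedean point `1` (`ιinf 1 = 1`): the
non-vanishing scalar lift of `φ_N = j (ι ℓ)` is a value of the theta form `thetaForm j χ⁻`, which is therefore
`≠ 0`, holomorphic after restriction (`hol`), hence descends to a non-zero `(1,0)`-class lying in `thetaClasses`
and so in `T.Theta V c k Γ₀(N)` (`theta_sub`). -/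
theorem residualT_of_classSupplyDataAt (S : ∀ N : ℕ, 0 < N → P.ClassSupplyDataAt T V c k N) :
    P.ResidualT T V c k := by
  intro N χ hN hχ hne
  obtain ⟨j, hj, ℓ, hjℓ⟩ := (S N hN).fam
  have hf : charInv χ ∈ (S N hN).𝓕 := (S N hN).char_mem χ hχ
  have h1 : P.kernelDatum.thetaLiftFun (probHaarRelNormOneQuot K L) (j.1 ((S N hN).ι ℓ)) (charInv χ)
      ((S N hN).ιinf 1) ≠ 0 := by
    rw [hjℓ, map_one]
    exact hne
  obtain ⟨cl, hcl, hcl0⟩ := P.kernelDatum.exists_thetaClass_mem_H10_ne_zero (probHaarRelNormOneQuot K L)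
    P.kernelDatum_thetaLinear (S N hN).κ (S N hN).σ (S N hN).ι (S N hN).hι (S N hN).ιinf (S N hN).D hj hf h1
    ((S N hN).hol j hj _ hf)
  exact ⟨(S N hN).Γ₀, (cl : U.CohC (U.pms Lc ι₁ V (S N hN).Γ₀) 1), (S N hN).theta_sub hcl,
    mt (Submodule.coe_eq_zero).mp hcl0⟩

/-- (W-res) from level-indexed class data. -/
theorem residual_of_classSupplyDataAt (S : ∀ N : ℕ, 0 < N → P.ClassSupplyDataAt T V c k N) :
    P.toLineData.Residual T V c k :=
  P.residual_of_residualT (P.residualT_of_classSupplyDataAt S)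

/-- **Supply of type index `k`** from pair data and level-indexed class data: KERNEL. -/
theorem supply_of_classSupplyDataAt (S : ∀ N : ℕ, 0 < N → P.ClassSupplyDataAt T V c k N) :
    ∃ Γ : Level V, ∃ ω ∈ T.Theta V c k Γ, ω ≠ 0 :=
  P.supply (P.residualT_of_classSupplyDataAt S)

/-- Consistency with the fixed-level kernel: `ClassSupplyData.residualT` factors through the constant family. -/
theorem ClassSupplyData.residualT_eq_of_toAt (S : P.ClassSupplyData T V c k) :
    S.residualT = P.residualT_of_classSupplyDataAt S.toAt := rfl

end WeilPairData

/-! ### § 3. `Open_supply` from carriers + pair data + level-indexed class data in every good context -/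

/-- Carriers, pair Weil data and LEVEL-INDEXED class supply data for the type index `k` in the context `(V, c)`:
for every `N ≥ 1` a class-level record at `φ_N` (its level `Γ₀(N)`, `K`-types `Kc(N)`, arithmetic subgroup
`Δ(N)`, class-map datum `D(N)` and families `𝓙(N)` chosen for that `N`). -/
structure ClassSupplyPackN {U : Universe} (T : U.ThetaModel) {Lc : CMField} {ι₁ : Lc →+* ℂ}
    (V : HermSpace3 Lc ι₁) (c : SeesawCtx Lc) (k : Fin 4) : Type 1 where
  /-- the base field `K = L₀` -/
  K : Type
  /-- the CM extension `L / K` -/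
  L : Type
  instK : Field K
  instKnf : NumberField K
  instL : Field L
  instLnf : NumberField L
  instAlg : Algebra K L
  instFD : FiniteDimensional K L
  /-- the Lagrangian index type -/
  J : Type
  instJ : Fintype J
  /-- the adelic group `G_U(𝔸)` -/
  GU : Type
  instGU : Group GU
  instGUtop : TopologicalSpace GU
  instGUtg : IsTopologicalGroup GU
  instGUlc : LocallyCompactSpace GU
  /-- the pair Weil data -/
  P : WeilPairData K L J GU
  /-- `[G_U]` is compact (anisotropic `V`) -/
  instCompact : CompactSpace (GU ⧸ P.ΓU)
  /-- the level-indexed class supply data: a record at `φ_N` for every `N ≥ 1` -/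
  cls : ∀ N : ℕ, 0 < N → P.ClassSupplyDataAt T V c k N

attribute [instance] ClassSupplyPackN.instK ClassSupplyPackN.instKnf ClassSupplyPackN.instL
  ClassSupplyPackN.instLnf ClassSupplyPackN.instAlg ClassSupplyPackN.instFD ClassSupplyPackN.instJ
  ClassSupplyPackN.instGU ClassSupplyPackN.instGUtop ClassSupplyPackN.instGUtg ClassSupplyPackN.instGUlc
  ClassSupplyPackN.instCompact

/-- A level-indexed class supply pack gives pair supply data: the residual is PROVED
(`WeilPairData.residualT_of_classSupplyDataAt`). -/
def ClassSupplyPackN.toPairSupplyData {U : Universe} {T : U.ThetaModel} {Lc : CMField} {ι₁ : Lc →+* ℂ}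
    {V : HermSpace3 Lc ι₁} {c : SeesawCtx Lc} {k : Fin 4} (S : ClassSupplyPackN T V c k) :
    PairSupplyData T V c k where
  K := S.K
  L := S.L
  instK := S.instK
  instKnf := S.instKnf
  instL := S.instL
  instLnf := S.instLnf
  instAlg := S.instAlg
  instFD := S.instFD
  J := S.J
  instJ := S.instJ
  GU := S.GU
  instGU := S.instGU
  instGUtop := S.instGUtop
  instGUtg := S.instGUtg
  instGUlc := S.instGUlc
  P := S.P
  instCompact := S.instCompact
  res := S.P.residualT_of_classSupplyDataAt S.cls

/-- The gen-2 (fixed-level) class supply pack gives a level-indexed one (constant family). -/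
def ClassSupplyPack.toN {U : Universe} {T : U.ThetaModel} {Lc : CMField} {ι₁ : Lc →+* ℂ}
    {V : HermSpace3 Lc ι₁} {c : SeesawCtx Lc} {k : Fin 4} (S : ClassSupplyPack T V c k) :
    ClassSupplyPackN T V c k where
  K := S.K
  L := S.L
  instK := S.instK
  instKnf := S.instKnf
  instL := S.instL
  instLnf := S.instLnf
  instAlg := S.instAlg
  instFD := S.instFD
  J := S.J
  instJ := S.instJ
  GU := S.GU
  instGU := S.instGU
  instGUtop := S.instGUtop
  instGUtg := S.instGUtg
  instGUlc := S.instGUlc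
  P := S.P
  instCompact := S.instCompact
  cls := S.cls.toAt

/-- **`Open_supply` BY NAME from level-indexed class supply packs** for the type indices `0, 1` in every good
context — no residual hypothesis left in the supply lane, and no fixed-level equivariance asked of the test
functions. -/
theorem open_supply_of_classSupplyPackN {U : Universe} (T : U.ThetaModel)
    (h : ∀ {Lc : CMField} {ι₁ : Lc →+* ℂ} (V : HermSpace3 Lc ι₁) (c : SeesawCtx Lc), T.GoodCtx ι₁ c →
      Nonempty (ClassSupplyPackN T V c 0) ∧ Nonempty (ClassSupplyPackN T V c 1)) :
    T.Open_supply :=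
  open_supply_of_pairSupplyData T fun V c hc =>
    ⟨(h V c hc).1.map ClassSupplyPackN.toPairSupplyData, (h V c hc).2.map ClassSupplyPackN.toPairSupplyData⟩

/-- The gen-2 hypothesis shape implies the level-indexed one (so an assembler re-based on
`open_supply_of_classSupplyPackN` still accepts fixed-level packs). -/
theorem classSupplyPackN_of_classSupplyPack {U : Universe} (T : U.ThetaModel)
    (h : ∀ {Lc : CMField} {ι₁ : Lc →+* ℂ} (V : HermSpace3 Lc ι₁) (c : SeesawCtx Lc), T.GoodCtx ι₁ c →
      Nonempty (ClassSupplyPack T V c 0) ∧ Nonempty (ClassSupplyPack T V c 1)) :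
    ∀ {Lc : CMField} {ι₁ : Lc →+* ℂ} (V : HermSpace3 Lc ι₁) (c : SeesawCtx Lc), T.GoodCtx ι₁ c →
      Nonempty (ClassSupplyPackN T V c 0) ∧ Nonempty (ClassSupplyPackN T V c 1) :=
  fun V c hc => ⟨(h V c hc).1.map ClassSupplyPack.toN, (h V c hc).2.map ClassSupplyPack.toN⟩

end SupplyResidual
end Model
end HodgeCM

end
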